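import Mathlib
import HarnessLib
import Summits.ABC.ABC.Theses.TwistAmplification
import Literature.NumberTheory.Automorphic.BrandtXi

/-!
# Sketch — crux SomeWindowSaving (stmt-ABC-1976), ideator 3, round 1

First-lemma signatures for the idea cards in `Ideas/`. Nothing here is proved; every
statement must elaborate over existing declarations.
-/

namespace Summit.ABC.ABC.Cruxes.SomeWindowSaving.CofiniteCollapse

open Summit.ABC.ABC.Theses.TwistAmplification

/-- `C⁺`: weak generalized Szpiro, COFINITE in the conductor, with the crux's own exclusions
(`c₄ c₆ ≠ 0`, reduced minimal integral models are not needed for an upper bound). -/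
def WeakGenSzpiroCofinite : Prop :=
  ∃ K N₀ C : ℝ, ∀ W₀ : WeierstrassCurve ℤ, (W₀.baseChange ℚ).IsElliptic →
    (∀ v : IsDedekindDomain.HeightOneSpectrum ℤ, (W₀.baseChange ℚ).IsMinimalAt v) →
    W₀.c₄ ≠ 0 → W₀.c₆ ≠ 0 →
    N₀ ≤ (((W₀.baseChange ℚ).conductorNorm ℤ : ℕ) : ℝ) →
      ((max |W₀.Δ| (|W₀.c₄| ^ 3) : ℤ) : ℝ) ≤
        C * (((W₀.baseChange ℚ).conductorNorm ℤ : ℕ) : ℝ) ^ K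

/-- FIRST LEMMA (easy direction, provable now): with `κ := K + 1`, `σ := K + 2` the window is
empty beyond conductor `max N₀ C`, and finite below it, so `T⁺ ≤ const = const · X ^ 0` and
`0 < (σ − κ)/(2σ − 6) = 1/(2K − 2)` for `K > 1`. -/
theorem someWindowSaving_of_weakGenSzpiroCofinite :
    WeakGenSzpiroCofinite → SomeWindowSaving := by
  sorry

/-- TAUTOLOGY THEOREM (converse): given Tate's twist facts, a count below the amplification
threshold forces `limsup β⁺ ≤ σ* := (κ − 6δ)/(1 − 2δ)`: a violator of ratio `s ∈ (σ*, σ]` and large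
conductor has `≫ X^{(s−κ)/(2s−6)} > C X^δ` twists in the window; a violator of ratio `> σ` twists
DOWN through the slice `(σ*, σ]` in steps `O(1/log N₀)`. No statistical residue remains. -/
theorem weakGenSzpiroCofinite_of_someWindowSaving :
    QuadraticTwistInvariants → SomeWindowSaving → WeakGenSzpiroCofinite := by
  sorry

/-- Weak Hall, coprime form: `|x| ≤ C · |x³ − y²| ^ K`. OPEN for every `K` ("it is not yet possible
to prove for any θ > 0 that |k| ≫ x^θ", Elkies 2000, recorded in
`Literature.Barriers.ABC.HallExponentSharp`). -/
def WeakHallCoprime : Prop :=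
  ∃ K C : ℝ, 0 < C ∧ ∀ x y : ℤ, IsCoprime x y → x ^ 3 ≠ y ^ 2 →
    (|x| : ℝ) ≤ C * ((|x ^ 3 - y ^ 2| : ℤ) : ℝ) ^ K

/-- The crux CONTAINS weak Hall (via the `c₄`-branch of `max(|Δ|, |c₄|³)` on the Mordell-type curves
`Y² = X³ − 3xX − 2y`, conductor `∣ 1728 · rad(x³ − y²)²`). -/
theorem weakHall_of_someWindowSaving :
    QuadraticTwistInvariants → SomeWindowSaving → WeakHallCoprime := by
  sorry

/-- Population (P): `j(E) ∈ ℤ` iff `Δ ∣ c₄³` iff potentially good reduction everywhere. Then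
`|Δ_min| ≤ C · N ^ (11/2)` unconditionally (Kodaira bounds `v_p(Δ) ≤ 10`, `f_p ≥ 2`), so the whole
content is a polynomial bound for `|c₄|³ = |j| · |Δ|`, i.e. for the integral `j`-invariant. -/
def IntegralJPolyBound : Prop :=
  ∃ K C : ℝ, ∀ W₀ : WeierstrassCurve ℤ, (W₀.baseChange ℚ).IsElliptic →
    (∀ v : IsDedekindDomain.HeightOneSpectrum ℤ, (W₀.baseChange ℚ).IsMinimalAt v) →
    W₀.c₄ ≠ 0 → W₀.c₆ ≠ 0 → W₀.Δ ∣ W₀.c₄ ^ 3 →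
      (((|W₀.c₄| ^ 3 : ℤ)) : ℝ) ≤ C * (((W₀.baseChange ℚ).conductorNorm ℤ : ℕ) : ℝ) ^ K

/-- Population (M): `j(E) ∉ ℤ`, i.e. some prime of potentially multiplicative reduction
(`I_n` or `I_n^*`); a quadratic twist by `p*` makes it multiplicative at `p` at polynomial cost. -/
def PotMultPolyBound : Prop :=
  ∃ K C : ℝ, ∀ W₀ : WeierstrassCurve ℤ, (W₀.baseChange ℚ).IsElliptic →
    (∀ v : IsDedekindDomain.HeightOneSpectrum ℤ, (W₀.baseChange ℚ).IsMinimalAt v) →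
    W₀.c₄ ≠ 0 → W₀.c₆ ≠ 0 → ¬ (W₀.Δ ∣ W₀.c₄ ^ 3) →
      ((max |W₀.Δ| (|W₀.c₄| ^ 3) : ℤ) : ℝ) ≤
        C * (((W₀.baseChange ℚ).conductorNorm ℤ : ℕ) : ℝ) ^ K

/-- Dichotomy glue (pure logic + `Δ ∣ c₄³ ∧ c₄ ≠ 0 → |Δ| ≤ |c₄|³`). -/
theorem weakGenSzpiroCofinite_of_dichotomy :
    PotMultPolyBound → IntegralJPolyBound → WeakGenSzpiroCofinite := by
  sorry

/-- Population (M), proposed engine: the weak definite-quaternion rung for ALL curves with an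
odd prime `q ∥ N` (not only Frey curves as in `DefiniteXi.XiBound`): the primitive integral
Jacquet–Langlands eigenvector on the class set of the Eichler order of level `N/q` in the
definite algebra of discriminant `q` has squared norm `ξ ≤ C · N ^ A`. -/
def XiBoundAll : Prop :=
  ∃ A C : ℝ, ∀ W₀ : WeierstrassCurve ℤ, (W₀.baseChange ℚ).IsElliptic →
    (∀ v : IsDedekindDomain.HeightOneSpectrum ℤ, (W₀.baseChange ℚ).IsMinimalAt v) →
    ∀ (N : ℕ) [NeZero N], (W₀.baseChange ℚ).conductorNorm ℤ = N →
    ∀ q : ℕ, q.Prime → q ≠ 2 → q ∣ N → ¬ (q ^ 2 ∣ N) →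
      (Literature.NumberTheory.Automorphic.brandtXi (N / q) q
          (fun n => (W₀.baseChange ℚ).LFunction n) : ℝ) ≤ C * (N : ℝ) ^ A

/-- Population (P) in Thue–Hall form: `j = A·X³`, `j − 1728 = B·Y²` (A cube-free, B squarefree, supported on
additive primes, `|A| ≤ 36·N`, `|B| ≤ 6·√N`), so `A·X³ − B·Y² = 1728 = 12³`; the statement asks for `|X|`
polynomial in `|A·B|` (equivalently: weak Hall for `U³ − V² = 1728·A²·B³`, `(U,V) = (ABX, AB²Y)`). -/
def ThueHall1728 : Prop :=
  ∃ K C : ℝ, ∀ A B X Y : ℤ, A ≠ 0 → B ≠ 0 → A * X ^ 3 - B * Y ^ 2 = 1728 →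
    (|X| : ℝ) ≤ C * ((|A * B| : ℤ) : ℝ) ^ K

/-- Card descent-thue-small-large, first lemma: the Thue–Hall form implies the integral-`j` population bound
(bookkeeping: twist-minimal model, Kodaira exponents at `p ≥ 5` in `{2,3,4,6,8,9,10}`, `|Δ_min| ≤ C·N⁵`,
`(rad₅ A · rad₅ B)² ∣ N`). -/
theorem integralJPolyBound_of_thueHall1728 : ThueHall1728 → IntegralJPolyBound := by
  sorry

end Summit.ABC.ABC.Cruxes.SomeWindowSaving.CofiniteCollapse
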